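import Summits.Ventures.Crystal3D.Theorems.StickyWulffConstantCoaxialWallLawRegisteredCore
import Summits.Ventures.Crystal3D.Theorems.StickyWulffConstantCoaxialWallLawChainTorsionWide
import Summits.Ventures.Crystal3D.Theorems.StickyWulffConstantCoaxialWallLawInPlaneStackWalkersWide
import Summits.Ventures.Crystal3D.Theorems.StickyWulffConstantCoaxialWallLawMenuFrames
import HarnessLib

/-!
# The VICINAL CORE of lane F: `CoaxialTwoSlabAdhesion` ⇐ {E1, `StarPairFar`, vicinal core}
# (crux `CoaxialWallLaw`, stmt-Ventures-19481, line `WallLedgerF`)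

HONEST FRAMING. Venture `Summits/Ventures/Crystal3D` (cell `crystal3d-full`), helper `--supports` the crux `CoaxialWallLaw`
of `route-Ventures-StickyWulffConstant` (REGISTERED line `WallLedgerF`, open stub `stub_coaxialTwoSlabAdhesion`).  Book-keeping
by theorem; rung credit; F-C1 not moved; NOT the crux: the VICINAL CORE defined here is what remains, and `ExactOnly`(C12-55)
[E1] / `StarPairFar` stay BY NAME.  Refines `CoaxialTwoSlabAdhesionRegistered` (`…RegisteredCore`, 19481-p1 g10) by folding in
two landed arbitrary-filling rungs with their `∃ L` packaging (`…CoaxialWallLawMenuFrames`):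

* WIDE TWINS (19480-p1's in-plane stack walkers, `twoSlabLedger_twin_inPlane_wide_of_inner_ge`, p631135/`…Wide`): every twin
  pair about a menu normal `ν` with `(√3/2)·sin∠(ν, e₃) ≥ 9/20` (`sin ≥ 0.52`) satisfies the stub's conclusion VERBATIM with the
  frame `L e₃ = ν` — `coaxialTwoSlabAdhesion_of_twin_wide`;
* WIDE SLOTS (`coaxialTwoSlabAdhesion_of_level_third_wide`, p645912): a level-⅓ pair whose offset lies outside the two fault
  cosets of the planes through a slot `u₁` of `e₃`-component `≥ 9/20` satisfies the stub's conclusion with ANY admissible axis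
  `m` of the pair (a menu normal of grain 1 with `A₂·Λ₀ ∈ {A₁·Λ₀, R_m A₁·Λ₀}`) whose charge the slot dominates,
  `√(1 − ⟪m, e₃⟫²) ≤ √2·⟪A₁u₁, e₃⟫` — `coaxialTwoSlabAdhesion_of_wide_slot`.
Hence **`CoaxialTwoSlabAdhesionVicinal`** := the registered stub restricted to co-axial pairs that are (i) TRIADIC, (ii) if a
twin then VICINAL (`(√3/2) sin θ < 9/20`), (iii) if of level ⅓ then REGISTERED for every wide slot dominating an admissible
axis; **`coaxialTwoSlabAdhesion_of_vicinal`**: {E1, `StarPairFar`, vicinal core} ⇒ the stub IN FULL;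
`coaxialTwoSlabAdhesionVicinal_of_registered` / `…_of_stub`: nothing smuggled (registered core ⇒ vicinal core ⇐ stub).
READING.  What the vicinal core still contains: basal stacking-fault staircases and coherent Σ3 twins with `sin θ < 0.52`
registered for all wide slots (the census STEP-2/3 objects), the single-wide-slot incoherent level-⅓ classes, and the deeper
(`3^{-j}`, `j ≥ 2`) basal-tower offsets.
WHAT THIS IS NOT: a proof of the core; F-C1 not moved.
-/

noncomputable section

namespace Summit.Ventures.Crystal3D.Theorems

open Summit.Ventures.Crystal3D Finset
open Summit.Ventures.Crystal3D.Cruxes.CoaxialWallLaw.WallLedgerF (CoaxialTwoSlabAdhesion)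
open Literature.MathematicalPhysics.StatisticalMechanics (fccStacking barlowStacking IsHaggSeq contactDeficiency
  constHagg isHaggSeq_const)
open scoped InnerProductSpace

open scoped Classical in
/-- **Wide twins, stub-shaped.**  A twin pair about a unit menu normal `ν` of grain 1 with `(√3/2)·√(1 − ⟪ν, e₃⟫²) ≥ 9/20`
satisfies the conclusion of `stub_coaxialTwoSlabAdhesion` (frame `L e₃ = ν`, charge `½ sin θ`), ARBITRARY fillings, modulo
`ExactOnly`(C12-55) and `StarPairFar`. -/
theorem coaxialTwoSlabAdhesion_of_twin_wide
    {s₀ : EuclideanSpace ℝ (Fin 3)} (hs₀ : s₀ ∈ fccSlots)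
    (hcert : ExactOnly 0 (fccSlots.filter fun w => 0 < ⟪w, s₀⟫_ℝ)) (hSP : StarPairFar)
    (A₁ : EuclideanSpace ℝ (Fin 3) ≃ₗᵢ[ℝ] EuclideanSpace ℝ (Fin 3)) (t₁ : EuclideanSpace ℝ (Fin 3))
    (A₂ : EuclideanSpace ℝ (Fin 3) ≃ₗᵢ[ℝ] EuclideanSpace ℝ (Fin 3)) (t₂ : EuclideanSpace ℝ (Fin 3))
    {ν : EuclideanSpace ℝ (Fin 3)} (hν : ‖ν‖ = 1)
    (hmenu : ∀ w ∈ fccSlots, ⟪A₁ w, ν⟫_ℝ = 0 ∨ ⟪A₁ w, ν⟫_ℝ = Real.sqrt (2 / 3) ∨ ⟪A₁ w, ν⟫_ℝ = -Real.sqrt (2 / 3))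
    (htwin : A₂ '' fccStacking 1 (Real.sqrt (2 / 3)) = twinFrame A₁ ν '' fccStacking 1 (Real.sqrt (2 / 3)))
    (hwide : (9 / 20 : ℝ) ≤ Real.sqrt 3 / 2 * Real.sqrt (1 - ⟪ν, EuclideanSpace.single (2 : Fin 3) (1 : ℝ)⟫_ℝ ^ 2)) :
    ∃ (L : EuclideanSpace ℝ (Fin 3) ≃ₗᵢ[ℝ] EuclideanSpace ℝ (Fin 3))
        (s₁ s₂ : EuclideanSpace ℝ (Fin 3)) (σ σ' : ℤ → ℤ), IsHaggSeq σ ∧ IsHaggSeq σ' ∧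
        (fun p => A₁ p + t₁) '' fccStacking 1 (Real.sqrt (2 / 3)) ⊆
          (fun p => L p + s₁) '' barlowStacking 1 (Real.sqrt (2 / 3)) σ ∧
        (fun p => A₂ p + t₂) '' fccStacking 1 (Real.sqrt (2 / 3)) ⊆
          (fun p => L p + s₂) '' barlowStacking 1 (Real.sqrt (2 / 3)) σ' ∧
    ∃ C R₀ : ℝ, 1 ≤ R₀ ∧ ∀ h : ℝ, 0 ≤ h → ∀ ρ : ℝ, R₀ ≤ ρ →
      ∀ X P₁ P₂ : Finset (EuclideanSpace ℝ (Fin 3)),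
      (∀ p ∈ X, ∀ q ∈ X, p ≠ q → 1 ≤ dist p q) → P₁ ⊆ X → P₂ ⊆ X \ P₁ →
      (∀ p ∈ X, -(2 * R₀) ≤ p 2 ∧ p 2 ≤ h + 2 * R₀ ∧ p 0 ^ 2 + p 1 ^ 2 ≤ ρ ^ 2) →
      (∀ p, p ∈ P₁ ↔ (p ∈ (fun q => A₁ q + t₁) '' fccStacking 1 (Real.sqrt (2 / 3)) ∧
        -(2 * R₀) ≤ p 2 ∧ p 2 ≤ -R₀ ∧ p 0 ^ 2 + p 1 ^ 2 ≤ ρ ^ 2)) →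
      (∀ p, p ∈ P₂ ↔ (p ∈ (fun q => A₂ q + t₂) '' fccStacking 1 (Real.sqrt (2 / 3)) ∧
        h + R₀ ≤ p 2 ∧ p 2 ≤ h + 2 * R₀ ∧ p 0 ^ 2 + p 1 ^ 2 ≤ ρ ^ 2)) →
      ((((P₁ ×ˢ (X \ P₁)).filter fun pq => dist pq.1 pq.2 = 1).card : ℕ) : ℝ) +
        ((((P₂ ×ˢ ((X \ P₁) \ P₂)).filter fun pq => dist pq.1 pq.2 = 1).card : ℕ) : ℝ) ≤
        contactDeficiency ((X \ P₁) \ P₂) +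
          (Real.sqrt 2 / 4 * ∑ᶠ w ∈ {w ∈ fccStacking 1 (Real.sqrt (2 / 3)) | ‖w‖ = 1},
              |⟪w, A₁.symm (EuclideanSpace.single (2 : Fin 3) (1 : ℝ))⟫_ℝ| +
            Real.sqrt 2 / 4 * ∑ᶠ w ∈ {w ∈ fccStacking 1 (Real.sqrt (2 / 3)) | ‖w‖ = 1},
              |⟪w, A₂.symm (EuclideanSpace.single (2 : Fin 3) (1 : ℝ))⟫_ℝ| -
            (1 / 2 : ℝ) * Real.sqrt (1 - ⟪L (EuclideanSpace.single (2 : Fin 3) (1 : ℝ)),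
              (EuclideanSpace.single (2 : Fin 3) (1 : ℝ))⟫_ℝ ^ 2)) * Real.pi * ρ ^ 2 +
          C * (1 + h) * ρ := by
  set e : EuclideanSpace ℝ (Fin 3) := EuclideanSpace.single (2 : Fin 3) (1 : ℝ) with he
  -- the in-plane slot of the twin plane with the largest `e₃`-component
  have hlt : ⟪ν, e⟫_ℝ ^ 2 < 1 := by
    by_contra hge
    push Not at hge
    have : Real.sqrt (1 - ⟪ν, e⟫_ℝ ^ 2) = 0 := Real.sqrt_eq_zero'.2 (by linarith)
    rw [this, mul_zero] at hwide
    norm_num at hwide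
  obtain ⟨w, hw, hwν, hwe⟩ := exists_inPlane_slot_ge_sin A₁ hν hmenu hlt
  have hup : (9 / 20 : ℝ) ≤ ⟪A₁ w, e⟫_ℝ := hwide.trans hwe
  -- the twin as a one-letter word frame
  set μ : EuclideanSpace ℝ (Fin 3) := A₁.symm ν with hμ
  have hμu : ‖μ‖ = 1 := by rw [hμ, LinearIsometryEquiv.norm_map, hν]
  have hμm : ∀ w ∈ fccSlots, ⟪w, μ⟫_ℝ = 0 ∨ ⟪w, μ⟫_ℝ = Real.sqrt (2 / 3) ∨ ⟪w, μ⟫_ℝ = -Real.sqrt (2 / 3) := by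
    intro w' hw'
    rw [hμ, ← LinearIsometryEquiv.inner_map_map A₁, LinearIsometryEquiv.apply_symm_apply]
    exact hmenu w' hw'
  have htw : twinFrame A₁ ν = wordFrame A₁ [μ] := by rw [twinFrame_eq_reflection_trans A₁ hν]; rfl
  have hA₂ : A₂ '' fccStacking 1 (Real.sqrt (2 / 3)) = (wordFrame A₁ [μ]) '' fccStacking 1 (Real.sqrt (2 / 3)) := by
    rw [htwin, htw]
  have hplane : ⟪w, μ⟫_ℝ = 0 := by
    rw [hμ, ← LinearIsometryEquiv.inner_map_map A₁, LinearIsometryEquiv.apply_symm_apply]; exact hwν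
  have hcell := twoSlabLedger_twin_inPlane_wide_of_inner_ge hs₀ hcert hSP A₁ t₁ A₂ t₂ ⟨hμu, hμm⟩ hA₂ hw hplane hup
  -- the frame with axis `ν`
  obtain ⟨L, hLΛ, hLe⟩ := exists_frame_of_menu A₁ hν hmenu
  have hsub₂ := movedFcc_subset_frame_negConst (twin_image_eq_frame_negConst hν hLΛ hLe htwin) t₂
  refine coaxialStub_of_twoSlabLedgerAt_frame hcell L t₁ t₂ isHaggSeq_const isHaggSeq_negConst
    (movedFcc_subset_frame hLΛ t₁) hsub₂ ?_
  rw [hLe]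
  have hsq0 : 0 ≤ Real.sqrt (1 - ⟪ν, e⟫_ℝ ^ 2) := Real.sqrt_nonneg _
  have h6 := sqrt6_div_four_mul_le hwe
  have h62 : (2 : ℝ) ≤ Real.sqrt 6 := by
    rw [show (2 : ℝ) = Real.sqrt (2 ^ 2) by rw [Real.sqrt_sq (by norm_num)]]
    exact Real.sqrt_le_sqrt (by norm_num)
  nlinarith

open scoped Classical in
/-- **Wide slots with an admissible axis, stub-shaped.**  A level-⅓ pair (translation, or twin about `n₁`), a slot `u₁` of
grain 1 with `⟪A₁u₁, e₃⟫ ≥ 9/20` and `⟪A₁u₁, n₁⟫ = √(2/3)`, the offset OUTSIDE `A₁·(Λ₀ + ℤ√(2/3)n₁ + ℤ√(2/3)n₂)`, and an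
admissible axis `m` (unit menu normal of grain 1 with `A₂·Λ₀ ∈ {A₁·Λ₀, R_m A₁·Λ₀}`) dominated by the slot,
`√(1 − ⟪m, e₃⟫²) ≤ √2·⟪A₁u₁, e₃⟫`: the conclusion of `stub_coaxialTwoSlabAdhesion` with the frame `L e₃ = m`, ARBITRARY
fillings, modulo `ExactOnly`(C12-55) and `StarPairFar`. -/
theorem coaxialTwoSlabAdhesion_of_wide_slot
    {s₀ : EuclideanSpace ℝ (Fin 3)} (hs₀ : s₀ ∈ fccSlots)
    (hcert : ExactOnly 0 (fccSlots.filter fun w => 0 < ⟪w, s₀⟫_ℝ)) (hSP : StarPairFar)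
    (A₁ : EuclideanSpace ℝ (Fin 3) ≃ₗᵢ[ℝ] EuclideanSpace ℝ (Fin 3)) (t₁ : EuclideanSpace ℝ (Fin 3))
    (A₂ : EuclideanSpace ℝ (Fin 3) ≃ₗᵢ[ℝ] EuclideanSpace ℝ (Fin 3)) (t₂ : EuclideanSpace ℝ (Fin 3))
    {m : EuclideanSpace ℝ (Fin 3)} (hm : ‖m‖ = 1)
    (hmenum : ∀ w ∈ fccSlots, ⟪A₁ w, m⟫_ℝ = 0 ∨ ⟪A₁ w, m⟫_ℝ = Real.sqrt (2 / 3) ∨ ⟪A₁ w, m⟫_ℝ = -Real.sqrt (2 / 3))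
    (hadm : A₂ '' fccStacking 1 (Real.sqrt (2 / 3)) = A₁ '' fccStacking 1 (Real.sqrt (2 / 3)) ∨
      A₂ '' fccStacking 1 (Real.sqrt (2 / 3)) = twinFrame A₁ m '' fccStacking 1 (Real.sqrt (2 / 3)))
    {u₁ n₁ : EuclideanSpace ℝ (Fin 3)} (hu₁ : u₁ ∈ fccSlots)
    (hup : (9 / 20 : ℝ) ≤ ⟪A₁ u₁, EuclideanSpace.single (2 : Fin 3) (1 : ℝ)⟫_ℝ)
    (hdom : Real.sqrt (1 - ⟪m, EuclideanSpace.single (2 : Fin 3) (1 : ℝ)⟫_ℝ ^ 2) ≤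
      Real.sqrt 2 * ⟪A₁ u₁, EuclideanSpace.single (2 : Fin 3) (1 : ℝ)⟫_ℝ)
    (hn₁ : ‖n₁‖ = 1)
    (hmenu₁ : ∀ w ∈ fccSlots, ⟪A₁ w, n₁⟫_ℝ = 0 ∨ ⟪A₁ w, n₁⟫_ℝ = Real.sqrt (2 / 3) ∨ ⟪A₁ w, n₁⟫_ℝ = -Real.sqrt (2 / 3))
    (hun : ⟪A₁ u₁, n₁⟫_ℝ = Real.sqrt (2 / 3))
    (hΛ : A₂ '' fccStacking 1 (Real.sqrt (2 / 3)) = A₁ '' fccStacking 1 (Real.sqrt (2 / 3)) ∨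
      A₂ '' fccStacking 1 (Real.sqrt (2 / 3)) = twinFrame A₁ n₁ '' fccStacking 1 (Real.sqrt (2 / 3)))
    (h3 : A₁.symm ((3 : ℝ) • (t₂ - t₁)) ∈ fccStacking 1 (Real.sqrt (2 / 3)))
    (hnot : ∀ a b : ℤ, A₁.symm (t₂ - t₁ - (a : ℝ) • (Real.sqrt (2 / 3) • n₁) -
      (b : ℝ) • (Real.sqrt (2 / 3) • ((2 * Real.sqrt (2 / 3)) • A₁ u₁ - n₁))) ∉ fccStacking 1 (Real.sqrt (2 / 3))) :
    ∃ (L : EuclideanSpace ℝ (Fin 3) ≃ₗᵢ[ℝ] EuclideanSpace ℝ (Fin 3))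
        (s₁ s₂ : EuclideanSpace ℝ (Fin 3)) (σ σ' : ℤ → ℤ), IsHaggSeq σ ∧ IsHaggSeq σ' ∧
        (fun p => A₁ p + t₁) '' fccStacking 1 (Real.sqrt (2 / 3)) ⊆
          (fun p => L p + s₁) '' barlowStacking 1 (Real.sqrt (2 / 3)) σ ∧
        (fun p => A₂ p + t₂) '' fccStacking 1 (Real.sqrt (2 / 3)) ⊆
          (fun p => L p + s₂) '' barlowStacking 1 (Real.sqrt (2 / 3)) σ' ∧
    ∃ C R₀ : ℝ, 1 ≤ R₀ ∧ ∀ h : ℝ, 0 ≤ h → ∀ ρ : ℝ, R₀ ≤ ρ →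
      ∀ X P₁ P₂ : Finset (EuclideanSpace ℝ (Fin 3)),
      (∀ p ∈ X, ∀ q ∈ X, p ≠ q → 1 ≤ dist p q) → P₁ ⊆ X → P₂ ⊆ X \ P₁ →
      (∀ p ∈ X, -(2 * R₀) ≤ p 2 ∧ p 2 ≤ h + 2 * R₀ ∧ p 0 ^ 2 + p 1 ^ 2 ≤ ρ ^ 2) →
      (∀ p, p ∈ P₁ ↔ (p ∈ (fun q => A₁ q + t₁) '' fccStacking 1 (Real.sqrt (2 / 3)) ∧
        -(2 * R₀) ≤ p 2 ∧ p 2 ≤ -R₀ ∧ p 0 ^ 2 + p 1 ^ 2 ≤ ρ ^ 2)) →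
      (∀ p, p ∈ P₂ ↔ (p ∈ (fun q => A₂ q + t₂) '' fccStacking 1 (Real.sqrt (2 / 3)) ∧
        h + R₀ ≤ p 2 ∧ p 2 ≤ h + 2 * R₀ ∧ p 0 ^ 2 + p 1 ^ 2 ≤ ρ ^ 2)) →
      ((((P₁ ×ˢ (X \ P₁)).filter fun pq => dist pq.1 pq.2 = 1).card : ℕ) : ℝ) +
        ((((P₂ ×ˢ ((X \ P₁) \ P₂)).filter fun pq => dist pq.1 pq.2 = 1).card : ℕ) : ℝ) ≤
        contactDeficiency ((X \ P₁) \ P₂) +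
          (Real.sqrt 2 / 4 * ∑ᶠ w ∈ {w ∈ fccStacking 1 (Real.sqrt (2 / 3)) | ‖w‖ = 1},
              |⟪w, A₁.symm (EuclideanSpace.single (2 : Fin 3) (1 : ℝ))⟫_ℝ| +
            Real.sqrt 2 / 4 * ∑ᶠ w ∈ {w ∈ fccStacking 1 (Real.sqrt (2 / 3)) | ‖w‖ = 1},
              |⟪w, A₂.symm (EuclideanSpace.single (2 : Fin 3) (1 : ℝ))⟫_ℝ| -
            (1 / 2 : ℝ) * Real.sqrt (1 - ⟪L (EuclideanSpace.single (2 : Fin 3) (1 : ℝ)),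
              (EuclideanSpace.single (2 : Fin 3) (1 : ℝ))⟫_ℝ ^ 2)) * Real.pi * ρ ^ 2 +
          C * (1 + h) * ρ := by
  obtain ⟨L, hLΛ, hLe⟩ := exists_frame_of_menu A₁ hm hmenum
  have hsub₁ := movedFcc_subset_frame hLΛ t₁
  have hcmp : (1 / 2 : ℝ) * Real.sqrt (1 - ⟪L (EuclideanSpace.single (2 : Fin 3) (1 : ℝ)),
      (EuclideanSpace.single (2 : Fin 3) (1 : ℝ))⟫_ℝ ^ 2) ≤
      Real.sqrt 2 * ⟪A₁ u₁, EuclideanSpace.single (2 : Fin 3) (1 : ℝ)⟫_ℝ / 2 := by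
    rw [hLe]; linarith
  rcases hadm with hadm | hadm
  · exact coaxialTwoSlabAdhesion_of_level_third_wide hs₀ hcert hSP A₁ t₁ A₂ t₂ L t₁ t₂ isHaggSeq_const isHaggSeq_const
      hsub₁ (movedFcc_subset_frame (hLΛ.trans hadm.symm) t₂) hu₁ hup hn₁ hmenu₁ hun hΛ h3 hnot hcmp
  · exact coaxialTwoSlabAdhesion_of_level_third_wide hs₀ hcert hSP A₁ t₁ A₂ t₂ L t₁ t₂ isHaggSeq_const isHaggSeq_negConst
      hsub₁ (movedFcc_subset_frame_negConst (twin_image_eq_frame_negConst hm hLΛ hLe hadm) t₂) hu₁ hup hn₁ hmenu₁ hun hΛ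
      h3 hnot hcmp

/-- **The VICINAL CORE of lane F**: `stub_coaxialTwoSlabAdhesion` restricted to co-axial pairs whose offset is triadic, whose
twins are vicinal (`(√3/2)·sin θ < 9/20`), and which — if of level ⅓ — are REGISTERED (inside the two fault cosets) for every
slot of `e₃`-component `≥ 9/20` that dominates an admissible axis of the pair. -/
def CoaxialTwoSlabAdhesionVicinal : Prop :=
    ∀ (A₁ : EuclideanSpace ℝ (Fin 3) ≃ₗᵢ[ℝ] EuclideanSpace ℝ (Fin 3)) (t₁ : EuclideanSpace ℝ (Fin 3))
      (A₂ : EuclideanSpace ℝ (Fin 3) ≃ₗᵢ[ℝ] EuclideanSpace ℝ (Fin 3)) (t₂ : EuclideanSpace ℝ (Fin 3)),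
    (∃ (L : EuclideanSpace ℝ (Fin 3) ≃ₗᵢ[ℝ] EuclideanSpace ℝ (Fin 3))
        (s₁ s₂ : EuclideanSpace ℝ (Fin 3)) (σ σ' : ℤ → ℤ), IsHaggSeq σ ∧ IsHaggSeq σ' ∧
        (fun p => A₁ p + t₁) '' fccStacking 1 (Real.sqrt (2 / 3)) ⊆
          (fun p => L p + s₁) '' barlowStacking 1 (Real.sqrt (2 / 3)) σ ∧
        (fun p => A₂ p + t₂) '' fccStacking 1 (Real.sqrt (2 / 3)) ⊆
          (fun p => L p + s₂) '' barlowStacking 1 (Real.sqrt (2 / 3)) σ') →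
    (fun p => A₁ p + t₁) '' fccStacking 1 (Real.sqrt (2 / 3)) ≠
      (fun p => A₂ p + t₂) '' fccStacking 1 (Real.sqrt (2 / 3)) →
    -- (i) triadic offset
    (∃ j : ℕ, ((3 : ℝ) ^ j) • A₁.symm (t₂ - t₁) ∈ fccStacking 1 (Real.sqrt (2 / 3))) →
    -- (ii) twins are vicinal
    (∀ ν : EuclideanSpace ℝ (Fin 3), ‖ν‖ = 1 →
      (∀ w ∈ fccSlots, ⟪A₁ w, ν⟫_ℝ = 0 ∨ ⟪A₁ w, ν⟫_ℝ = Real.sqrt (2 / 3) ∨ ⟪A₁ w, ν⟫_ℝ = -Real.sqrt (2 / 3)) →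
      A₂ '' fccStacking 1 (Real.sqrt (2 / 3)) = twinFrame A₁ ν '' fccStacking 1 (Real.sqrt (2 / 3)) →
      Real.sqrt 3 / 2 * Real.sqrt (1 - ⟪ν, EuclideanSpace.single (2 : Fin 3) (1 : ℝ)⟫_ℝ ^ 2) < 9 / 20) →
    -- (iii) level ⅓ ⇒ registered for every wide slot dominating an admissible axis
    (A₁.symm ((3 : ℝ) • (t₂ - t₁)) ∈ fccStacking 1 (Real.sqrt (2 / 3)) →
      ∀ m : EuclideanSpace ℝ (Fin 3), ‖m‖ = 1 →
      (∀ w ∈ fccSlots, ⟪A₁ w, m⟫_ℝ = 0 ∨ ⟪A₁ w, m⟫_ℝ = Real.sqrt (2 / 3) ∨ ⟪A₁ w, m⟫_ℝ = -Real.sqrt (2 / 3)) →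
      (A₂ '' fccStacking 1 (Real.sqrt (2 / 3)) = A₁ '' fccStacking 1 (Real.sqrt (2 / 3)) ∨
        A₂ '' fccStacking 1 (Real.sqrt (2 / 3)) = twinFrame A₁ m '' fccStacking 1 (Real.sqrt (2 / 3))) →
      ∀ u₁ ∈ fccSlots, (9 / 20 : ℝ) ≤ ⟪A₁ u₁, EuclideanSpace.single (2 : Fin 3) (1 : ℝ)⟫_ℝ →
      Real.sqrt (1 - ⟪m, EuclideanSpace.single (2 : Fin 3) (1 : ℝ)⟫_ℝ ^ 2) ≤
        Real.sqrt 2 * ⟪A₁ u₁, EuclideanSpace.single (2 : Fin 3) (1 : ℝ)⟫_ℝ →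
      ∀ n₁ : EuclideanSpace ℝ (Fin 3), ‖n₁‖ = 1 →
      (∀ w ∈ fccSlots, ⟪A₁ w, n₁⟫_ℝ = 0 ∨ ⟪A₁ w, n₁⟫_ℝ = Real.sqrt (2 / 3) ∨ ⟪A₁ w, n₁⟫_ℝ = -Real.sqrt (2 / 3)) →
      ⟪A₁ u₁, n₁⟫_ℝ = Real.sqrt (2 / 3) →
      (A₂ '' fccStacking 1 (Real.sqrt (2 / 3)) = A₁ '' fccStacking 1 (Real.sqrt (2 / 3)) ∨
        A₂ '' fccStacking 1 (Real.sqrt (2 / 3)) = twinFrame A₁ n₁ '' fccStacking 1 (Real.sqrt (2 / 3))) →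
      ∃ a b : ℤ, A₁.symm (t₂ - t₁ - (a : ℝ) • (Real.sqrt (2 / 3) • n₁) -
        (b : ℝ) • (Real.sqrt (2 / 3) • ((2 * Real.sqrt (2 / 3)) • A₁ u₁ - n₁))) ∈ fccStacking 1 (Real.sqrt (2 / 3))) →
    ∃ (L : EuclideanSpace ℝ (Fin 3) ≃ₗᵢ[ℝ] EuclideanSpace ℝ (Fin 3))
        (s₁ s₂ : EuclideanSpace ℝ (Fin 3)) (σ σ' : ℤ → ℤ), IsHaggSeq σ ∧ IsHaggSeq σ' ∧
        (fun p => A₁ p + t₁) '' fccStacking 1 (Real.sqrt (2 / 3)) ⊆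
          (fun p => L p + s₁) '' barlowStacking 1 (Real.sqrt (2 / 3)) σ ∧
        (fun p => A₂ p + t₂) '' fccStacking 1 (Real.sqrt (2 / 3)) ⊆
          (fun p => L p + s₂) '' barlowStacking 1 (Real.sqrt (2 / 3)) σ' ∧
    ∃ C R₀ : ℝ, 1 ≤ R₀ ∧ ∀ h : ℝ, 0 ≤ h → ∀ ρ : ℝ, R₀ ≤ ρ →
      ∀ X P₁ P₂ : Finset (EuclideanSpace ℝ (Fin 3)),
      (∀ p ∈ X, ∀ q ∈ X, p ≠ q → 1 ≤ dist p q) → P₁ ⊆ X → P₂ ⊆ X \ P₁ →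
      (∀ p ∈ X, -(2 * R₀) ≤ p 2 ∧ p 2 ≤ h + 2 * R₀ ∧ p 0 ^ 2 + p 1 ^ 2 ≤ ρ ^ 2) →
      (∀ p, p ∈ P₁ ↔ (p ∈ (fun q => A₁ q + t₁) '' fccStacking 1 (Real.sqrt (2 / 3)) ∧
        -(2 * R₀) ≤ p 2 ∧ p 2 ≤ -R₀ ∧ p 0 ^ 2 + p 1 ^ 2 ≤ ρ ^ 2)) →
      (∀ p, p ∈ P₂ ↔ (p ∈ (fun q => A₂ q + t₂) '' fccStacking 1 (Real.sqrt (2 / 3)) ∧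
        h + R₀ ≤ p 2 ∧ p 2 ≤ h + 2 * R₀ ∧ p 0 ^ 2 + p 1 ^ 2 ≤ ρ ^ 2)) →
      ((((P₁ ×ˢ (X \ P₁)).filter fun pq => dist pq.1 pq.2 = 1).card : ℕ) : ℝ) +
        ((((P₂ ×ˢ ((X \ P₁) \ P₂)).filter fun pq => dist pq.1 pq.2 = 1).card : ℕ) : ℝ) ≤
        contactDeficiency ((X \ P₁) \ P₂) +
          (Real.sqrt 2 / 4 * ∑ᶠ w ∈ {w ∈ fccStacking 1 (Real.sqrt (2 / 3)) | ‖w‖ = 1},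
              |⟪w, A₁.symm (EuclideanSpace.single (2 : Fin 3) (1 : ℝ))⟫_ℝ| +
            Real.sqrt 2 / 4 * ∑ᶠ w ∈ {w ∈ fccStacking 1 (Real.sqrt (2 / 3)) | ‖w‖ = 1},
              |⟪w, A₂.symm (EuclideanSpace.single (2 : Fin 3) (1 : ℝ))⟫_ℝ| -
            (1 / 2 : ℝ) * Real.sqrt (1 - ⟪L (EuclideanSpace.single (2 : Fin 3) (1 : ℝ)),
              (EuclideanSpace.single (2 : Fin 3) (1 : ℝ))⟫_ℝ ^ 2)) * Real.pi * ρ ^ 2 +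
          C * (1 + h) * ρ

/-- Nothing is smuggled: the registered stub implies the vicinal core. -/
theorem coaxialTwoSlabAdhesionVicinal_of_stub (h : CoaxialTwoSlabAdhesion) : CoaxialTwoSlabAdhesionVicinal :=
  fun A₁ t₁ A₂ t₂ hco hne _ _ _ => h A₁ t₁ A₂ t₂ hco hne

/-- **The registered core implies the vicinal core** (the vicinal core is the SMALLER debt): a steep slot (`≥ √2/2`)
dominates every axis, so hypothesis (iii) of the vicinal core contains hypothesis (ii) of the registered core. -/
theorem coaxialTwoSlabAdhesionVicinal_of_registered (h : CoaxialTwoSlabAdhesionRegistered) :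
    CoaxialTwoSlabAdhesionVicinal := by
  intro A₁ t₁ A₂ t₂ hco hne htri _ hreg
  refine h A₁ t₁ A₂ t₂ hco hne htri fun h3 u₁ hu₁ hsteep n₁ hn₁ hmenu₁ hun hΛ => ?_
  have h22 : Real.sqrt 2 * (Real.sqrt 2 / 2) = 1 := by
    have : Real.sqrt 2 ^ 2 = 2 := Real.sq_sqrt (by norm_num)
    nlinarith
  have hup : (9 / 20 : ℝ) ≤ ⟪A₁ u₁, EuclideanSpace.single (2 : Fin 3) (1 : ℝ)⟫_ℝ := by
    have : (9 / 20 : ℝ) ≤ Real.sqrt 2 / 2 := by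
      rw [show (9 / 20 : ℝ) = Real.sqrt ((9 / 20) ^ 2) by rw [Real.sqrt_sq (by norm_num)],
        show Real.sqrt 2 / 2 = Real.sqrt (2 / 4) by rw [Real.sqrt_div (by norm_num), show (4:ℝ) = 2 ^ 2 by norm_num,
          Real.sqrt_sq (by norm_num)]]
      exact Real.sqrt_le_sqrt (by norm_num)
    exact this.trans hsteep
  have hdom : Real.sqrt (1 - ⟪n₁, EuclideanSpace.single (2 : Fin 3) (1 : ℝ)⟫_ℝ ^ 2) ≤
      Real.sqrt 2 * ⟪A₁ u₁, EuclideanSpace.single (2 : Fin 3) (1 : ℝ)⟫_ℝ := by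
    have h1 := sqrt_one_sub_inner_sq_le_one n₁
    have h2 : (1 : ℝ) ≤ Real.sqrt 2 * ⟪A₁ u₁, EuclideanSpace.single (2 : Fin 3) (1 : ℝ)⟫_ℝ := by
      have := mul_le_mul_of_nonneg_left hsteep (Real.sqrt_nonneg 2)
      linarith
    linarith
  rcases hΛ with hΛ | hΛ
  · exact hreg h3 n₁ hn₁ hmenu₁ (Or.inl hΛ) u₁ hu₁ hup hdom n₁ hn₁ hmenu₁ hun (Or.inl hΛ)
  · exact hreg h3 n₁ hn₁ hmenu₁ (Or.inr hΛ) u₁ hu₁ hup hdom n₁ hn₁ hmenu₁ hun (Or.inr hΛ)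

open scoped Classical in
/-- **The registered stub `CoaxialTwoSlabAdhesion` IN FULL from E1, `StarPairFar` and the vicinal core.** -/
theorem coaxialTwoSlabAdhesion_of_vicinal
    {s₀ : EuclideanSpace ℝ (Fin 3)} (hs₀ : s₀ ∈ fccSlots)
    (hcert : ExactOnly 0 (fccSlots.filter fun w => 0 < ⟪w, s₀⟫_ℝ)) (hSP : StarPairFar)
    (hcore : CoaxialTwoSlabAdhesionVicinal) : CoaxialTwoSlabAdhesion := by
  intro A₁ t₁ A₂ t₂ hco hne
  by_cases ht : ∃ j : ℕ, ((3 : ℝ) ^ j) • A₁.symm (t₂ - t₁) ∈ fccStacking 1 (Real.sqrt (2 / 3))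
  swap
  · exact coaxialTwoSlabAdhesion_of_not_triadic hs₀ hcert hSP A₁ t₁ A₂ t₂ hco ht
  by_cases hvic : ∀ ν : EuclideanSpace ℝ (Fin 3), ‖ν‖ = 1 →
      (∀ w ∈ fccSlots, ⟪A₁ w, ν⟫_ℝ = 0 ∨ ⟪A₁ w, ν⟫_ℝ = Real.sqrt (2 / 3) ∨ ⟪A₁ w, ν⟫_ℝ = -Real.sqrt (2 / 3)) →
      A₂ '' fccStacking 1 (Real.sqrt (2 / 3)) = twinFrame A₁ ν '' fccStacking 1 (Real.sqrt (2 / 3)) →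
      Real.sqrt 3 / 2 * Real.sqrt (1 - ⟪ν, EuclideanSpace.single (2 : Fin 3) (1 : ℝ)⟫_ℝ ^ 2) < 9 / 20
  swap
  · push Not at hvic
    obtain ⟨ν, hν, hmenu, htwin, hwide⟩ := hvic
    exact coaxialTwoSlabAdhesion_of_twin_wide hs₀ hcert hSP A₁ t₁ A₂ t₂ hν hmenu htwin hwide
  by_cases hreg : A₁.symm ((3 : ℝ) • (t₂ - t₁)) ∈ fccStacking 1 (Real.sqrt (2 / 3)) →
      ∀ m : EuclideanSpace ℝ (Fin 3), ‖m‖ = 1 →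
      (∀ w ∈ fccSlots, ⟪A₁ w, m⟫_ℝ = 0 ∨ ⟪A₁ w, m⟫_ℝ = Real.sqrt (2 / 3) ∨ ⟪A₁ w, m⟫_ℝ = -Real.sqrt (2 / 3)) →
      (A₂ '' fccStacking 1 (Real.sqrt (2 / 3)) = A₁ '' fccStacking 1 (Real.sqrt (2 / 3)) ∨
        A₂ '' fccStacking 1 (Real.sqrt (2 / 3)) = twinFrame A₁ m '' fccStacking 1 (Real.sqrt (2 / 3))) →
      ∀ u₁ ∈ fccSlots, (9 / 20 : ℝ) ≤ ⟪A₁ u₁, EuclideanSpace.single (2 : Fin 3) (1 : ℝ)⟫_ℝ →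
      Real.sqrt (1 - ⟪m, EuclideanSpace.single (2 : Fin 3) (1 : ℝ)⟫_ℝ ^ 2) ≤
        Real.sqrt 2 * ⟪A₁ u₁, EuclideanSpace.single (2 : Fin 3) (1 : ℝ)⟫_ℝ →
      ∀ n₁ : EuclideanSpace ℝ (Fin 3), ‖n₁‖ = 1 →
      (∀ w ∈ fccSlots, ⟪A₁ w, n₁⟫_ℝ = 0 ∨ ⟪A₁ w, n₁⟫_ℝ = Real.sqrt (2 / 3) ∨ ⟪A₁ w, n₁⟫_ℝ = -Real.sqrt (2 / 3)) →
      ⟪A₁ u₁, n₁⟫_ℝ = Real.sqrt (2 / 3) →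
      (A₂ '' fccStacking 1 (Real.sqrt (2 / 3)) = A₁ '' fccStacking 1 (Real.sqrt (2 / 3)) ∨
        A₂ '' fccStacking 1 (Real.sqrt (2 / 3)) = twinFrame A₁ n₁ '' fccStacking 1 (Real.sqrt (2 / 3))) →
      ∃ a b : ℤ, A₁.symm (t₂ - t₁ - (a : ℝ) • (Real.sqrt (2 / 3) • n₁) -
        (b : ℝ) • (Real.sqrt (2 / 3) • ((2 * Real.sqrt (2 / 3)) • A₁ u₁ - n₁))) ∈ fccStacking 1 (Real.sqrt (2 / 3))
  · exact hcore A₁ t₁ A₂ t₂ hco hne ht hvic hreg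
  push Not at hreg
  obtain ⟨h3, m, hm, hmenum, hadm, u₁, hu₁, hup, hdom, n₁, hn₁, hmenu₁, hun, hΛ, hnot⟩ := hreg
  exact coaxialTwoSlabAdhesion_of_wide_slot hs₀ hcert hSP A₁ t₁ A₂ t₂ hm hmenum hadm hu₁ hup hdom hn₁ hmenu₁ hun hΛ h3 hnot

end Summit.Ventures.Crystal3D.Theorems

end
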